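import Mathlib
import Literature.Analysis.Convexity.AnisotropicPerimeterPolytopePrism
import HarnessLib

/-!
# Open `H`-polytopes `⋂ {⟪a, x⟫ < b}`: closure, compactness, facet frames, chart parametrisation

Topic `Literature/Analysis/Convexity`; namespace `Literature.Analysis.Convexity`.
Elementary convex geometry of a finite intersection of OPEN half-spaces
`Q = ⋂_{p ∈ H} {x | ⟪p.1, x⟫ < p.2}` in a real inner product space and, in `ℝ³`, of the isometric
charts `y ↦ b•a + y₁ U + y₂ V` of its facet planes `{⟪a, x⟫ = b}` (`(U, V, a)` orthonormal):
* `closure_openHPolytope_eq` — for `Q ≠ ∅`, `closure Q = ⋂ {⟪p.1, x⟫ ≤ p.2}` (Rockafellar Thm 6.3: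
  `cl (ri C) = cl C` for the polyhedron `C`); `isCompact_closedHPolytope_of_isBounded`;
* `eq_chart_of_mem_plane` — every point of the plane `⟪a, x⟫ = ⟪a, p⟫` is `p + ⟪U, x−p⟫U + ⟪V, x−p⟫V`
  (so a facet chart maps `ℝ²` onto its plane: `image_chart_preimage_eq`); `norm_sq_eq_sum_sq_coord`.
Facet frames, the frame expansion and the chart/prism dictionary are in
`AnisotropicPerimeterPolytopePrism.lean` (`exists_orthonormal_pair_perp`, `frame_expansion_three`,
`inner_chart_eq`, `volume_prism_eq_volume_chartPreimage`), which this file imports.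
Plumbing for the facet formula of the anisotropic perimeter of open polytopes and their unions
(crystal3d-full, stmt-Ventures-19483 `stub_polytopeCalculus`).
[cite: Rockafellar1970, §6 Thm 6.3; EvansGariepy2015, Thm 5.16 (Gauss–Green), polyhedral case — plumbing]
-/

noncomputable section

namespace Literature.Analysis.Convexity

open Set
open scoped RealInnerProductSpace Topology

section General

variable {V : Type*} [NormedAddCommGroup V] [InnerProductSpace ℝ V]

/-- An open `H`-polytope is convex. [cite: Rockafellar1970, §2 Thm 2.1 — plumbing] -/
theorem convex_openHPolytope (H : Finset (V × ℝ)) :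
    Convex ℝ (⋂ p ∈ H, {x : V | ⟪p.1, x⟫ < p.2}) :=
  convex_iInter₂ fun p _ => by
    simpa using convex_halfSpace_lt (innerSL ℝ p.1).isLinear p.2

/-- An open `H`-polytope is open. [cite: Rockafellar1970, §2 Thm 2.1 — plumbing] -/
theorem isOpen_openHPolytope (H : Finset (V × ℝ)) :
    IsOpen (⋂ p ∈ H, {x : V | ⟪p.1, x⟫ < p.2}) :=
  isOpen_biInter_finset fun _ _ => isOpen_lt (continuous_const.inner continuous_id) continuous_const

/-- A closed `H`-polyhedron is closed. [cite: Rockafellar1970, §2 Thm 2.1 — plumbing] -/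
theorem isClosed_closedHPolytope (H : Finset (V × ℝ)) :
    IsClosed (⋂ p ∈ H, {x : V | ⟪p.1, x⟫ ≤ p.2}) :=
  isClosed_biInter fun _ _ => isClosed_le (continuous_const.inner continuous_id) continuous_const

/-- A closed `H`-polyhedron is convex. [cite: Rockafellar1970, §2 Thm 2.1 — plumbing] -/
theorem convex_closedHPolytope (H : Finset (V × ℝ)) :
    Convex ℝ (⋂ p ∈ H, {x : V | ⟪p.1, x⟫ ≤ p.2}) :=
  convex_iInter₂ fun p _ => by
    simpa using convex_halfSpace_le (innerSL ℝ p.1).isLinear p.2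

/-- The open `H`-polytope lies in the closed one. [cite: Rockafellar1970, §6 Thm 6.3 — plumbing] -/
theorem openHPolytope_subset_closedHPolytope (H : Finset (V × ℝ)) :
    (⋂ p ∈ H, {x : V | ⟪p.1, x⟫ < p.2}) ⊆ ⋂ p ∈ H, {x : V | ⟪p.1, x⟫ ≤ p.2} := by
  intro x hx
  simp only [mem_iInter, mem_setOf_eq] at hx ⊢
  exact fun p hp => (hx p hp).le

/-- The open segment from a point of the open polytope to a point of the closed polyhedron lies in
the open polytope. [cite: Rockafellar1970, §6 Thm 6.1 — plumbing] -/
theorem openSegment_subset_openHPolytope (H : Finset (V × ℝ)) {x₀ x : V}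
    (hx₀ : x₀ ∈ ⋂ p ∈ H, {x : V | ⟪p.1, x⟫ < p.2}) (hx : x ∈ ⋂ p ∈ H, {x : V | ⟪p.1, x⟫ ≤ p.2}) :
    openSegment ℝ x₀ x ⊆ ⋂ p ∈ H, {x : V | ⟪p.1, x⟫ < p.2} := by
  simp only [mem_iInter, mem_setOf_eq] at hx₀ hx
  rintro z ⟨s, t, hs, ht, hst, rfl⟩
  simp only [mem_iInter, mem_setOf_eq]
  intro p hp
  rw [inner_add_right, inner_smul_right, inner_smul_right]
  have h1 : s * ⟪p.1, x₀⟫ < s * p.2 := mul_lt_mul_of_pos_left (hx₀ p hp) hs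
  have h2 : t * ⟪p.1, x⟫ ≤ t * p.2 := mul_le_mul_of_nonneg_left (hx p hp) ht.le
  calc s * ⟪p.1, x₀⟫ + t * ⟪p.1, x⟫ < s * p.2 + t * p.2 := by linarith
    _ = p.2 := by rw [← add_mul, hst, one_mul]

/-- **Closure of a nonempty open `H`-polytope is the closed polyhedron** (`cl (ri C) = cl C`).
[cite: Rockafellar1970, §6 Thm 6.3] -/
theorem closure_openHPolytope_eq (H : Finset (V × ℝ))
    (hne : (⋂ p ∈ H, {x : V | ⟪p.1, x⟫ < p.2}).Nonempty) :
    closure (⋂ p ∈ H, {x : V | ⟪p.1, x⟫ < p.2}) = ⋂ p ∈ H, {x : V | ⟪p.1, x⟫ ≤ p.2} := by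
  refine Subset.antisymm
    (closure_minimal (openHPolytope_subset_closedHPolytope H) (isClosed_closedHPolytope H)) ?_
  intro x hx
  obtain ⟨x₀, hx₀⟩ := hne
  have hseg : segment ℝ x₀ x ⊆ closure (⋂ p ∈ H, {x : V | ⟪p.1, x⟫ < p.2}) :=
    (segment_subset_closure_openSegment).trans
      (closure_mono (openSegment_subset_openHPolytope H hx₀ hx))
  exact hseg (right_mem_segment ℝ x₀ x)

/-- A bounded nonempty open `H`-polytope has COMPACT closure `⋂ {⟪p.1, x⟫ ≤ p.2}`.
[cite: Rockafellar1970, §6 Thm 6.3 — plumbing] -/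
theorem isCompact_closedHPolytope_of_isBounded [FiniteDimensional ℝ V] (H : Finset (V × ℝ))
    (hne : (⋂ p ∈ H, {x : V | ⟪p.1, x⟫ < p.2}).Nonempty)
    (hbd : Bornology.IsBounded (⋂ p ∈ H, {x : V | ⟪p.1, x⟫ < p.2})) :
    IsCompact (⋂ p ∈ H, {x : V | ⟪p.1, x⟫ ≤ p.2}) := by
  rw [← closure_openHPolytope_eq H hne]
  exact Metric.isCompact_of_isClosed_isBounded isClosed_closure hbd.closure

/-- The OPEN FACET `{⟪c.1, x⟫ = c.2, all other constraints strict}` lies in the closed polyhedron.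
[cite: Rockafellar1970, §6 Thm 6.3 — plumbing] -/
theorem openFacet_subset_closedHPolytope (J : Finset (V × ℝ)) {c : V × ℝ} :
    {x : V | ⟪c.1, x⟫ = c.2 ∧ ∀ c' ∈ J, c' ≠ c → ⟪c'.1, x⟫ < c'.2} ⊆
      ⋂ p ∈ J, {x : V | ⟪p.1, x⟫ ≤ p.2} := by
  intro x hx
  simp only [mem_iInter, mem_setOf_eq] at hx ⊢
  intro p hp
  by_cases hpc : p = c
  · rw [hpc]; exact hx.1.le
  · exact (hx.2 p hp hpc).le

/-- Open facets of DISTINCT constraints are separated: the open facet of `c` is disjoint from the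
CLOSURE of the open facet of `c' ≠ c` (the latter lies in the plane `⟪c'.1, x⟫ = c'.2`, on which the
former's strict inequality fails). [cite: Rockafellar1970, §6 Thm 6.3 — plumbing] -/
theorem disjoint_openFacet_closure_openFacet (J : Finset (V × ℝ)) {c c' : V × ℝ} (hc' : c' ∈ J)
    (hne : c' ≠ c) :
    Disjoint {x : V | ⟪c.1, x⟫ = c.2 ∧ ∀ c'' ∈ J, c'' ≠ c → ⟪c''.1, x⟫ < c''.2}
      (closure {x : V | ⟪c'.1, x⟫ = c'.2 ∧ ∀ c'' ∈ J, c'' ≠ c' → ⟪c''.1, x⟫ < c''.2}) := by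
  have hcl : closure {x : V | ⟪c'.1, x⟫ = c'.2 ∧ ∀ c'' ∈ J, c'' ≠ c' → ⟪c''.1, x⟫ < c''.2} ⊆
      {x : V | ⟪c'.1, x⟫ = c'.2} :=
    closure_minimal (fun x hx => hx.1)
      (isClosed_eq (continuous_const.inner continuous_id) continuous_const)
  rw [Set.disjoint_left]
  intro x hx hx'
  have h1 : ⟪c'.1, x⟫ < c'.2 := hx.2 c' hc' hne
  have h2 : ⟪c'.1, x⟫ = c'.2 := hcl hx'
  exact h1.ne h2

end General

/-! ### `ℝ³`: coordinate dictionary, facet frames and chart parametrisation -/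

section E3

/-- `‖x‖² = Σ_l x_l²` on `EuclideanSpace ℝ (Fin 3)`. [cite: EvansGariepy2015, Thm 5.16 — plumbing] -/
theorem norm_sq_eq_sum_sq_coord (x : EuclideanSpace ℝ (Fin 3)) : ‖x‖ ^ 2 = ∑ l, x l ^ 2 := by
  rw [EuclideanSpace.norm_eq, Real.sq_sqrt (Finset.sum_nonneg fun i _ => by positivity)]
  exact Finset.sum_congr rfl fun l _ => by rw [Real.norm_eq_abs, sq_abs]

/-- **Chart parametrisation of a facet plane**: for `(U, V, a)` orthonormal and `⟪a, x⟫ = ⟪a, p⟫`,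
`x = p + ⟪U, x − p⟫ U + ⟪V, x − p⟫ V`; in particular the chart `y ↦ p + y₁U + y₂V` maps `ℝ²` ONTO
the plane through `p` with normal `a`. [cite: EvansGariepy2015, Thm 5.16 — plumbing] -/
theorem eq_chart_of_mem_plane (U V a p x : EuclideanSpace ℝ (Fin 3)) (hU : ‖U‖ = 1) (hV : ‖V‖ = 1)
    (ha : ‖a‖ = 1) (hUV : ⟪U, V⟫ = 0) (haU : ⟪a, U⟫ = 0) (haV : ⟪a, V⟫ = 0) (hx : ⟪a, x⟫ = ⟪a, p⟫) :
    x = p + ⟪U, x - p⟫ • U + ⟪V, x - p⟫ • V := by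
  have h := (frame_expansion_three ha hU hV hUV haU haV (x - p)).symm
  have h0 : ⟪a, x - p⟫ = 0 := by rw [inner_sub_right, hx, sub_self]
  rw [h0, zero_smul, add_zero] at h
  rw [add_assoc, ← h]; abel

/-- The image of the chart `y ↦ p + y₁U + y₂V` of the plane `{⟪a, x⟫ = ⟪a, p⟫}` restricted to the
chart preimage of a subset `F` of that plane is `F` itself.
[cite: EvansGariepy2015, Thm 5.16 — plumbing] -/
theorem image_chart_preimage_eq (U V a p : EuclideanSpace ℝ (Fin 3)) (hU : ‖U‖ = 1) (hV : ‖V‖ = 1)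
    (ha : ‖a‖ = 1) (hUV : ⟪U, V⟫ = 0) (haU : ⟪a, U⟫ = 0) (haV : ⟪a, V⟫ = 0)
    {F : Set (EuclideanSpace ℝ (Fin 3))} (hF : F ⊆ {x | ⟪a, x⟫ = ⟪a, p⟫}) :
    (fun y : ℝ × ℝ => p + y.1 • U + y.2 • V) '' ((fun y : ℝ × ℝ => p + y.1 • U + y.2 • V) ⁻¹' F) = F := by
  refine Subset.antisymm (image_preimage_subset _ _) fun x hx => ?_
  refine ⟨(⟪U, x - p⟫, ⟪V, x - p⟫), ?_, ?_⟩
  · show p + ⟪U, x - p⟫ • U + ⟪V, x - p⟫ • V ∈ F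
    rw [← eq_chart_of_mem_plane U V a p x hU hV ha hUV haU haV (hF hx)]; exact hx
  · exact (eq_chart_of_mem_plane U V a p x hU hV ha hUV haU haV (hF hx)).symm

/-- The chart of the plane `⟪a, x⟫ = b` based at `b • a` lies in that plane (`‖a‖ = 1`, `U, V ⊥ a`).
[cite: EvansGariepy2015, Thm 5.16 — plumbing] -/
theorem inner_chart_base_eq (U V a : EuclideanSpace ℝ (Fin 3)) (b : ℝ) (ha : ‖a‖ = 1)
    (haU : ⟪a, U⟫ = 0) (haV : ⟪a, V⟫ = 0) (y : ℝ × ℝ) : ⟪a, b • a + y.1 • U + y.2 • V⟫ = b := by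
  rw [inner_chart_eq haU haV, inner_smul_right, real_inner_self_eq_norm_sq, ha]; ring

end E3

end Literature.Analysis.Convexity

end
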